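import Summits.FinalStateConjecture.FinalStateConjecture.Statement
import Literature.Geometry.Lorentzian.NormalisedNullRayCausal
import Literature.Geometry.Lorentzian.CausalityPushUp
import Literature.Geometry.Lorentzian.MinkowskiGlobalHyperbolicity
import Literature.Geometry.Lorentzian.KerrConvergenceProofs
import Literature.Geometry.Lorentzian.CauchyProblemProofs

/-!
# Solo (blind) — the dispersive final state (`N = 0`) packaged: a tied late flat chart settles

The `N = 0` ("the solution disperses") case of the conclusion of `FinalStateConjecture`, for an
ARBITRARY Cauchy development `𝒟 = (M, g, τ, ι, ν)` of a datum `D` on a `3`-manifold `X`, reduced to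
one chart-level hypothesis structure `SoloBlindTiedFlatChart 𝒟 k`: a late flat chart
`Ψ : E4 → M` after chart time `τ₀` which

* (a) is a late-time embedding for the whole carrier modelled on Minkowski space
  (`Spacetime.IsLateEmbedding Minkowski.background univ τ₀ Ψ`: smooth, an open embedding on
  `{x⁰ > τ₀}`, and every event not in `Ψ({x⁰ > τ₀})` lies in `J⁻(Ψ({x⁰ = τ₀}))`),
* (b) has `Cᵏ` deviation `Ψ^* g − η` on the slabs `{x⁰ = τ}` tending to `0` — (a) and (b) together
  are exactly `Spacetime.ConvergesToMinkowski univ k` with its chart exposed —,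
* (c) is TIED TO THE DATA: `Ψ({x⁰ > τ₀}) ⊆ J⁺(ι X)`, and
* (d) is FUTURE-ORIENTED AND TIMELIKE IN CHART TIME: `dΨ(∂₀)` is a future-directed timelike vector
  for `(g, τ)` at every chart point with `x⁰ ≥ τ₀`,

and the theorem `SoloBlindTiedFlatChart.settles`: such a chart yields a final state decomposition
`d` with NO black hole (`N = 0`, flat domain all of `E4`, flat chart `Ψ`) of the region
`O := J⁺(ι X)`, satisfying every clause of the summit's "settles down" conjunct:
`O = exteriorOf 𝒟 d.charted` (because `I⁻(Ψ({x⁰ > τ₀})) = M`, from (a), (d) and push-up),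
`RaysStayInClosure 𝒟 O` (a normalised null ray from the data is a future causal curve),
`HasExhaustiveCharts d` (from (a), (d) and push-up: everything outside `Ψ({x⁰ > τ₁})` is causally
before `Ψ({x⁰ = τ₁})`) and `IsFutureOriented d` (this is (d)); subextremality is vacuous.

Why (c) and (d) are listed separately (they are absent from the consequence form
`ConvergesToMinkowski univ k` of the stability of Minkowski space recorded in
`Literature.Geometry.Lorentzian.KerrConvergence` / `MinkowskiStabilityCauchy`): (F1) nothing in
`IsLateEmbedding` relates the chart to the data hypersurface `ι X` — in Minkowski space with the
flat slice `Σ = {t = 0}`, a Lorentz BOOST `Ψ = Λ` (orthochronous, `Λ ≠ 1`) is, after any `τ₀`, a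
late embedding for the whole space with deviation identically `0` and future timelike chart time,
whose late region `{t' > τ₀}` contains events with `t < 0`, i.e. is NOT contained in
`J⁺(Σ) = {t ≥ 0}`; since the statement forces `O = J⁺(ι X) ∩ I⁻(charted)` and a decomposition's
flat late image must lie in `O`, such a chart certifies nothing, and (c) is a genuine extra
requirement; (F2) (d) is not a field of `IsLateEmbedding`; for large chart times it is plausibly a
consequence of (a)–(b) (the `C⁰` deviation makes `dΨ(∂₀)` timelike, each slab is connected, and the
covering clause should exclude the past-directed alternative), but this is not pursued here: (d) is
assumed, for all `x⁰ ≥ τ₀`, which also keeps the causal bookkeeping elementary (push-up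
`J⁺ ∘ I⁺ ⊆ I⁺`, O'Neill 1983, Cor. 14.1, is used instead of `J⁺`-transitivity).

The companion file `SoloBlindDispersalSettles` records the correspondingly strengthened consequence
form of Christodoulou–Klainerman / Bieri as a hypothesis and derives rung r1b of the solo ladder
(small data disperse, in the typed sense of the statement). The printed theorems (CK 1993,
Thm. 10.2.1: the maximal foliation of the future of `Σ` with lapse `φ → 1` and `∂_t = φ T`, `T` the
future unit normal; Bieri 2010, Thm. 3) construct exactly such a chart on `J⁺(Σ)`, so (c) and (d)
are features of the proofs, not of the recorded consequence form.

References: D. Christodoulou, S. Klainerman, *The global nonlinear stability of the Minkowski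
space*, Princeton 1993, Thm. 1.0.3 (p. 20), Thm. 10.2.1 (p. 237); L. Bieri, *An extension of the
stability theorem of the Minkowski space in general relativity*, J. Differential Geom. 86 (2010),
Thm. 1 and Thm. 3 (arXiv:0904.0620, pp. 3, 10); B. O'Neill, *Semi-Riemannian geometry*, Academic
Press 1983, Ch. 14, p. 402 and Cor. 14.1; D. Christodoulou, CQG 16 (1999) A23, pp. A26–A27.
-/

noncomputable section

open Literature.Geometry.Lorentzian TopologicalSpace Manifold Filter Topology Set Function
open scoped ContDiff Topology ENNReal

namespace Summit.FinalStateConjecture.FinalStateConjecture.Theorems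

/-! ### Chart-time curves of a chart on the Minkowski background domain -/

section TimeCurve

variable {𝓢 : Spacetime.{0} 4}

/-- The **chart-time curve** `s ↦ Ψ(x + s ∂₀)` through the chart point `x` of a map `Ψ` on the
Minkowski background domain (all of `E4`). -/
def soloBlindTimeCurve (Ψ : Minkowski.background.domain → 𝓢.carrier)
    (x : Minkowski.background.domain) (s : ℝ) : 𝓢.carrier :=
  Ψ ⟨x.1 + s • E4.basisVector 0, trivial⟩

/-- The chart-time curve starts at `Ψ x`. -/
theorem soloBlind_timeCurve_zero (Ψ : Minkowski.background.domain → 𝓢.carrier)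
    (x : Minkowski.background.domain) : soloBlindTimeCurve Ψ x 0 = Ψ x := by
  rw [soloBlindTimeCurve]
  exact congrArg Ψ (Subtype.ext (by simp))

/-- **Velocity of the chart-time curve**: for a smooth `Ψ`, the curve `s ↦ Ψ(x + s ∂₀)` is
differentiable with velocity `dΨ_{x + s ∂₀}(∂₀)` (chain rule through the open submanifold
`⊤ ⊆ E4`, Lee 2013, Prop. 3.9; straight lines have constant velocity, O'Neill 1983, Ch. 3,
Ex. 3.25). -/
theorem soloBlind_velocity_timeCurve {Ψ : Minkowski.background.domain → 𝓢.carrier}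
    (hΨ : ContMDiff 𝓘(ℝ, E4) (𝓡 4) ∞ Ψ) (x : Minkowski.background.domain) (s : ℝ) :
    MDifferentiableAt 𝓘(ℝ, ℝ) (𝓡 4) (soloBlindTimeCurve Ψ x) s ∧
      velocity (𝓡 4) (soloBlindTimeCurve Ψ x) s =
        mfderiv 𝓘(ℝ, E4) (𝓡 4) Ψ ⟨x.1 + s • E4.basisVector 0, trivial⟩ (E4.basisVector 0) := by
  -- the chart read on the whole model space `E4`, and the straight chart-time line
  have hΦd : ∀ y : E4, MDifferentiableAt 𝓘(ℝ, E4) (𝓡 4) (fun y : E4 ↦ Ψ ⟨y, trivial⟩) y :=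
    fun y ↦ (mdifferentiableAt_comp_subtypeVal_iff (W := Minkowski.background.domain)
      (f := fun y : E4 ↦ Ψ ⟨y, trivial⟩) (y := ⟨y, trivial⟩)).mp (hΨ.mdifferentiableAt (by simp))
  have hℓd : HasDerivAt (fun s : ℝ ↦ x.1 + s • E4.basisVector 0) (E4.basisVector 0) s := by
    have h := ((hasDerivAt_id' s).smul_const (E4.basisVector 0)).const_add x.1
    rwa [one_smul] at h
  have hℓm : MDifferentiableAt 𝓘(ℝ, ℝ) 𝓘(ℝ, E4) (fun s : ℝ ↦ x.1 + s • E4.basisVector 0) s :=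
    mdifferentiableAt_iff_differentiableAt.mpr hℓd.differentiableAt
  have hvel : mfderiv 𝓘(ℝ, ℝ) 𝓘(ℝ, E4) (fun s : ℝ ↦ x.1 + s • E4.basisVector 0) s 1 =
      E4.basisVector 0 :=
    ModelSpace.velocity_line x.1 (E4.basisVector 0) s
  have hcurve : soloBlindTimeCurve Ψ x =
      (fun y : E4 ↦ Ψ ⟨y, trivial⟩) ∘ fun s : ℝ ↦ x.1 + s • E4.basisVector 0 := rfl
  rw [hcurve]
  refine ⟨(hΦd _).comp s hℓm, ?_⟩
  have hcomp := mfderiv_comp s (hΦd (x.1 + s • E4.basisVector 0)) hℓm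
  have h3 : mfderiv 𝓘(ℝ, ℝ) (𝓡 4)
      ((fun y : E4 ↦ Ψ ⟨y, trivial⟩) ∘ fun s : ℝ ↦ x.1 + s • E4.basisVector 0) s 1 =
      mfderiv 𝓘(ℝ, E4) (𝓡 4) (fun y : E4 ↦ Ψ ⟨y, trivial⟩) (x.1 + s • E4.basisVector 0)
        (mfderiv 𝓘(ℝ, ℝ) 𝓘(ℝ, E4) (fun s : ℝ ↦ x.1 + s • E4.basisVector 0) s 1) :=
    DFunLike.congr_fun hcomp 1
  have h4 : mfderiv 𝓘(ℝ, E4) (𝓡 4) (fun y : E4 ↦ Ψ ⟨y, trivial⟩) (x.1 + s • E4.basisVector 0)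
      (E4.basisVector 0) =
      mfderiv 𝓘(ℝ, E4) (𝓡 4) Ψ ⟨x.1 + s • E4.basisVector 0, trivial⟩ (E4.basisVector 0) :=
    (DFunLike.congr_fun (mfderiv_comp_subtypeVal' (I' := 𝓘(ℝ, E4)) (I := 𝓡 4)
      (W := Minkowski.background.domain) (fun y : E4 ↦ Ψ ⟨y, trivial⟩)
      ⟨x.1 + s • E4.basisVector 0, trivial⟩) (E4.basisVector 0)).symm
  exact h3.trans ((DFunLike.congr_arg (mfderiv 𝓘(ℝ, E4) (𝓡 4) (fun y : E4 ↦ Ψ ⟨y, trivial⟩)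
    (x.1 + s • E4.basisVector 0)) hvel).trans h4)

/-- **The chart-time curve is a future timelike curve on `s ≥ 0`** when `dΨ(∂₀)` is future-directed
timelike at all chart points with `x⁰ ≥ τ₀` and the curve starts at such a point.
O'Neill 1983, Ch. 5, p. 146. -/
theorem soloBlind_isFutureTimelikeCurveOn_timeCurve {Ψ : Minkowski.background.domain → 𝓢.carrier}
    (hΨ : ContMDiff 𝓘(ℝ, E4) (𝓡 4) ∞ Ψ) {τ₀ : ℝ}
    (hfut : ∀ y : Minkowski.background.domain, τ₀ ≤ y.1 0 →
      𝓢.metric.IsTimelike (mfderiv 𝓘(ℝ, E4) (𝓡 4) Ψ y (E4.basisVector 0)) ∧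
        𝓢.timeOrientation.IsFutureDirected (mfderiv 𝓘(ℝ, E4) (𝓡 4) Ψ y (E4.basisVector 0)))
    {x : Minkowski.background.domain} (hx : τ₀ ≤ x.1 0) :
    𝓢.metric.IsFutureTimelikeCurveOn 𝓢.timeOrientation (soloBlindTimeCurve Ψ x) (Ici 0) := by
  intro s hs
  obtain ⟨hd, hv⟩ := soloBlind_velocity_timeCurve hΨ x s
  have h0 : τ₀ ≤ (x.1 + s • E4.basisVector 0) 0 := by
    rw [show (x.1 + s • E4.basisVector 0) 0 = x.1 0 + s by simp]
    linarith [mem_Ici.1 hs]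
  obtain ⟨ht, hf⟩ := hfut ⟨_, trivial⟩ h0
  refine ⟨hd, ?_, ?_⟩
  · rw [hv]; exact ht
  · rw [hv]; exact hf

end TimeCurve

/-! ### The hypothesis structure: a tied, future-oriented late flat chart -/

section Development

variable {X : Type} [TopologicalSpace X] [ChartedSpace E3 X] [IsManifold (𝓡 3) ∞ X]
  [ConnectedSpace X] {D : InitialDataSet (𝓡 3) X}

/-- **Hypothesis structure: a tied late flat chart** of the Cauchy development `𝒟`, in `Cᵏ`.
A chart time `τ₀` and a map `Ψ` on the Minkowski background domain `E4` into `M` which is (a) a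
late-time embedding for the whole carrier modelled on Minkowski space after `τ₀`
(`Spacetime.IsLateEmbedding … univ τ₀ Ψ`), (b) along which the `Cᵏ` deviation `Ψ^* g − η` on the
slabs `{x⁰ = τ}` tends to `0`, (c) whose late region `Ψ({x⁰ > τ₀})` lies in the causal future
`J⁺(ι X)` of the data, and (d) whose chart-time vector `dΨ(∂₀)` is future-directed timelike at every
chart point with `x⁰ ≥ τ₀`. Items (a)–(b) are `ConvergesToMinkowski univ k` with the chart exposed
(Christodoulou–Klainerman 1993, Thm. 10.2.1; Bieri 2010, Thm. 3); (c)–(d) are the tie to the data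
and the orientation which the maximal-foliation charts of those proofs have and the recorded
consequence form omits. -/
structure SoloBlindTiedFlatChart (𝒟 : CauchyDevelopment D) (k : ℕ) where
  /-- The initial chart time. -/
  τ₀ : ℝ
  /-- The flat chart, on all of `E4`. -/
  chart : Minkowski.background.domain → 𝒟.carrier
  /-- (a) `chart` is a late-time embedding for the whole carrier after `τ₀`. -/
  isLateEmbedding : 𝒟.toSpacetime.IsLateEmbedding Minkowski.background univ τ₀ chart
  /-- (b) The `Cᵏ` deviation from `η` on the slabs `{x⁰ = τ}` tends to `0`. -/
  tendsto_deviationCk :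
    Tendsto (fun τ ↦ 𝒟.toSpacetime.deviationCk Minkowski.background chart k τ) atTop (𝓝 0)
  /-- (c) The late region is tied to the data: `chart({x⁰ > τ₀}) ⊆ J⁺(ι X)`. -/
  image_subset_causalFuture : chart '' Minkowski.background.lateRegion τ₀ ⊆
    𝒟.metric.causalFuture 𝒟.timeOrientation (range 𝒟.embed)
  /-- (d) Chart time is future timelike: `d(chart)(∂₀)` is timelike and future-directed at every
  chart point with `x⁰ ≥ τ₀`. -/
  isTimelike_isFutureDirected : ∀ x : Minkowski.background.domain, τ₀ ≤ x.1 0 →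
    𝒟.metric.IsTimelike (mfderiv 𝓘(ℝ, E4) (𝓡 4) chart x (E4.basisVector 0)) ∧
      𝒟.timeOrientation.IsFutureDirected (mfderiv 𝓘(ℝ, E4) (𝓡 4) chart x (E4.basisVector 0))

/-- The settled region used for the dispersive final state: the causal future `J⁺(ι X)` of the
data in the development `𝒟`. -/
def soloBlindDataFuture (𝒟 : CauchyDevelopment D) : Set 𝒟.carrier :=
  𝒟.metric.causalFuture 𝒟.timeOrientation (range 𝒟.embed)

namespace SoloBlindTiedFlatChart

variable {𝒟 : CauchyDevelopment D} {k : ℕ}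

/-- The late image `Ψ({x⁰ > τ₀})` of a tied flat chart. -/
def lateImage (c : SoloBlindTiedFlatChart 𝒟 k) : Set 𝒟.carrier :=
  c.chart '' Minkowski.background.lateRegion c.τ₀

/-- A tied flat chart exhibits convergence to Minkowski space on the whole carrier (items (a), (b)).
Christodoulou–Klainerman 1993, Thm. 10.2.1. -/
theorem convergesToMinkowski (c : SoloBlindTiedFlatChart 𝒟 k) :
    𝒟.toSpacetime.ConvergesToMinkowski univ k :=
  ⟨c.τ₀, c.chart, c.isLateEmbedding, c.tendsto_deviationCk⟩

/-- **Chart time pushes into the chronological future**: for a chart point `x` with `x⁰ ≥ τ₀` and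
`ℓ > 0`, `Ψ(x + ℓ ∂₀) ∈ I⁺(Ψ x)` along the chart-time curve. O'Neill 1983, Ch. 14, p. 402. -/
theorem timeCurve_mem_chronologicalFuture (c : SoloBlindTiedFlatChart 𝒟 k)
    {x : Minkowski.background.domain} (hx : c.τ₀ ≤ x.1 0) {ℓ : ℝ} (hℓ : 0 < ℓ) :
    soloBlindTimeCurve c.chart x ℓ ∈ 𝒟.metric.chronologicalFuture 𝒟.timeOrientation {c.chart x} :=
  ⟨c.chart x, rfl, soloBlindTimeCurve c.chart x, 0, ℓ, hℓ,
    (soloBlind_isFutureTimelikeCurveOn_timeCurve c.isLateEmbedding.contMDiff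
      c.isTimelike_isFutureDirected hx).mono Icc_subset_Ici_self,
    soloBlind_timeCurve_zero c.chart x, rfl⟩

/-- The point `Ψ(x + ℓ ∂₀)`, `ℓ > 0`, `x⁰ ≥ τ₀`, lies in the late image. -/
theorem timeCurve_mem_lateImage (c : SoloBlindTiedFlatChart 𝒟 k) {x : Minkowski.background.domain}
    (hx : c.τ₀ ≤ x.1 0) {ℓ : ℝ} (hℓ : 0 < ℓ) : soloBlindTimeCurve c.chart x ℓ ∈ c.lateImage :=
  ⟨⟨x.1 + ℓ • E4.basisVector 0, trivial⟩,
    show c.τ₀ < (x.1 + ℓ • E4.basisVector 0) 0 by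
      rw [show (x.1 + ℓ • E4.basisVector 0) 0 = x.1 0 + ℓ by simp]; linarith, rfl⟩

/-- The point `Ψ(x + (τ₁ - x⁰) ∂₀)` lies in the image of the slab `{x⁰ = τ₁}`. -/
theorem timeCurve_mem_image_timeSlab (c : SoloBlindTiedFlatChart 𝒟 k)
    (x : Minkowski.background.domain) (τ₁ : ℝ) :
    soloBlindTimeCurve c.chart x (τ₁ - x.1 0) ∈ c.chart '' Minkowski.background.timeSlab τ₁ :=
  ⟨⟨x.1 + (τ₁ - x.1 0) • E4.basisVector 0, trivial⟩,
    show (x.1 + (τ₁ - x.1 0) • E4.basisVector 0) 0 = τ₁ by simp, rfl⟩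

/-- **An event outside the late image is causally before a point of the initial slab image**:
`m ∉ Ψ({x⁰ > τ₀})` gives `m ∈ J⁻(Ψ y)` for some chart point `y` with `y⁰ = τ₀` (the covering clause
of `IsLateEmbedding` for the region `univ`). DHRT arXiv:2104.08222, §1. -/
theorem exists_mem_causalFuture_of_not_mem_lateImage (c : SoloBlindTiedFlatChart 𝒟 k)
    {m : 𝒟.carrier} (hm : m ∉ c.lateImage) :
    ∃ y : Minkowski.background.domain, y.1 0 = c.τ₀ ∧
      c.chart y ∈ 𝒟.metric.causalFuture 𝒟.timeOrientation {m} := by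
  have hm' := c.isLateEmbedding.diff_subset_causalPast ⟨mem_univ m, hm⟩
  change m ∈ 𝒟.metric.causalFuture 𝒟.timeOrientation.reverse _ at hm'
  rw [LorentzianMetric.causalFuture_eq_biUnion] at hm'
  simp only [mem_iUnion, exists_prop] at hm'
  obtain ⟨q, ⟨y, hy, rfl⟩, hmq⟩ := hm'
  exact ⟨y, hy, LorentzianMetric.mem_causalPast_singleton_iff.1 hmq⟩

/-- **`I⁻(Ψ({x⁰ > τ₀})) = M`**: every event is chronologically before the late image. An event
of the late image is pushed into it along its chart-time curve; any other event is causally before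
a point `Ψ y` of the initial slab, which is chronologically before `Ψ(y + ∂₀)` in the late image,
and `J⁺ ∘ I⁺ ⊆ I⁺` (push-up, O'Neill 1983, Ch. 14, Cor. 14.1). -/
theorem chronologicalPast_lateImage (c : SoloBlindTiedFlatChart 𝒟 k) :
    𝒟.metric.chronologicalPast 𝒟.timeOrientation c.lateImage = univ := by
  refine eq_univ_of_forall fun m ↦ ?_
  by_cases hm : m ∈ c.lateImage
  · obtain ⟨x, hx, rfl⟩ := hm
    have hx' : c.τ₀ ≤ x.1 0 := le_of_lt hx
    exact LorentzianMetric.chronologicalFuture_mono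
      (singleton_subset_iff.2 (c.timeCurve_mem_lateImage hx' one_pos))
      (LorentzianMetric.mem_chronologicalPast_of_mem_chronologicalFuture
        (c.timeCurve_mem_chronologicalFuture hx' one_pos))
  · obtain ⟨y, hy, hq⟩ := c.exists_mem_causalFuture_of_not_mem_lateImage hm
    have hr := LorentzianMetric.mem_chronologicalFuture_of_mem_causalFuture
      (WithTop.coe_le_coe.2 le_top) hq (c.timeCurve_mem_chronologicalFuture hy.ge one_pos)
    exact LorentzianMetric.chronologicalFuture_mono
      (singleton_subset_iff.2 (c.timeCurve_mem_lateImage hy.ge one_pos))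
      (LorentzianMetric.mem_chronologicalPast_of_mem_chronologicalFuture hr)

/-- **The `N = 0` final state decomposition of `J⁺(ι X)` carried by a tied flat chart**: no black
hole (all `Fin 0`-indexed data empty; separation and excision vacuous), flat domain all of `E4`,
flat chart `Ψ` after `τ₀` (a late chart into `J⁺(ι X)` by (a) and (c)), radiation-zone convergence
(b), and the covering clause of (a) restricted to `J⁺(ι X)`. The `N = 0` shape of
`FinalStateDecomposition.ofConvergesToMinkowski`; Christodoulou–Klainerman 1993, Thm. 1.0.3. -/
def decomposition (c : SoloBlindTiedFlatChart 𝒟 k) :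
    FinalStateDecomposition 𝒟.toSpacetime (soloBlindDataFuture 𝒟) k where
  N := 0
  mass := Fin.elim0
  spin := Fin.elim0
  mass_pos i := i.elim0
  abs_spin_le_mass i := i.elim0
  motion := Fin.elim0
  τ₀ := c.τ₀
  chart i := i.elim0
  isLateChart i := i.elim0
  tendsto_truncDeviationCk i := i.elim0
  exists_pairwise_disjoint _ := ⟨0, fun i ↦ i.elim0⟩
  excision := Fin.elim0
  tendsto_excision_div i := i.elim0
  flatDomain := ⊤
  setOf_lt_excision_subset_flatDomain _ _ := trivial
  flatChart := c.chart
  isLateChart_flat :=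
    { contMDiff := c.isLateEmbedding.contMDiff
      isOpenEmbedding := c.isLateEmbedding.isOpenEmbedding
      image_subset := c.image_subset_causalFuture }
  tendsto_deviationCk_flat := c.tendsto_deviationCk
  diff_subset_causalPast := by
    rw [Set.iUnion_of_empty, Set.empty_union, Set.iUnion_of_empty, Set.empty_union]
    exact fun m hm ↦ c.isLateEmbedding.diff_subset_causalPast ⟨mem_univ m, hm.2⟩

/-- The decomposition has no black hole (by `rfl`). -/
@[simp]
theorem decomposition_N (c : SoloBlindTiedFlatChart 𝒟 k) : c.decomposition.N = 0 := rfl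

/-- The charted late region of the decomposition is the late image `Ψ({x⁰ > τ₀})`. -/
theorem charted_decomposition (c : SoloBlindTiedFlatChart 𝒟 k) :
    c.decomposition.charted = c.lateImage := by
  haveI : IsEmpty (Fin c.decomposition.N) := Fin.isEmpty'
  rw [FinalStateDecomposition.charted, iUnion_of_empty, union_empty]
  rfl

/-- **`O = J⁺(ι X)` is the exterior of the statement**: `J⁺(ι X) ∩ I⁻(charted) = J⁺(ι X) ∩ M`. -/
theorem dataFuture_eq_exteriorOf (c : SoloBlindTiedFlatChart 𝒟 k) :
    soloBlindDataFuture 𝒟 = exteriorOf 𝒟 c.decomposition.charted := by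
  rw [charted_decomposition, exteriorOf, chronologicalPast_lateImage, inter_univ]
  rfl

/-- **Rays stay in the closure of `O = J⁺(ι X)`**: the points of parameter `t ≥ 0` of a normalised
null ray from the data lie in `J⁺(ι X)` itself (the ray is a future causal curve from `ι p`;
O'Neill 1983, Ch. 14, p. 402; Christodoulou, CQG 16 (1999), pp. A26–A27). Unboundedness of the
affine domain is not used. -/
theorem raysStayInClosure (𝒟 : CauchyDevelopment D) :
    RaysStayInClosure 𝒟 (soloBlindDataFuture 𝒟) := by
  intro inst p γ dom hray _ t ht ht0
  exact subset_closure (hray.mem_causalFuture_range ht ht0)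

/-- **The flat chart exhausts `O`** (clause `HasExhaustiveCharts`, `N = 0`: no radii to choose): for
`τ₁ > τ₀`, an event not in `Ψ({x⁰ > τ₁})` is either `Ψ x` with `τ₀ < x⁰ ≤ τ₁` — on the slab, or
chronologically before `Ψ(x + (τ₁ − x⁰) ∂₀)` on it — or causally before some `Ψ y` with `y⁰ = τ₀`,
itself chronologically before `Ψ(y + (τ₁ − τ₀) ∂₀)` on the slab, whence before the slab by push-up
(O'Neill 1983, Ch. 14, Cor. 14.1). -/
theorem hasExhaustiveCharts (c : SoloBlindTiedFlatChart 𝒟 k) :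
    HasExhaustiveCharts c.decomposition := by
  haveI : IsEmpty (Fin c.decomposition.N) := Fin.isEmpty'
  refine ⟨fun i ↦ i.elim0, fun i ↦ i.elim0, fun i ↦ i.elim0, fun τ₁ hτ₁ m hm ↦ ?_⟩
  obtain ⟨-, hmlate⟩ := hm
  rw [certifiedLate, iUnion_of_empty, union_empty] at hmlate
  rw [certifiedSlab, iUnion_of_empty, union_empty]
  change c.τ₀ < τ₁ at hτ₁
  change m ∉ c.chart '' Minkowski.background.lateRegion τ₁ at hmlate
  change m ∈ 𝒟.metric.causalPast 𝒟.timeOrientation (c.chart '' Minkowski.background.timeSlab τ₁)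
  by_cases hmL : m ∈ c.lateImage
  · obtain ⟨x, hx, rfl⟩ := hmL
    have hx0 : c.τ₀ ≤ x.1 0 := le_of_lt hx
    have hx1 : x.1 0 ≤ τ₁ := not_lt.1 fun h ↦ hmlate ⟨x, h, rfl⟩
    rcases hx1.eq_or_lt with hx1 | hx1
    · exact LorentzianMetric.subset_causalPast _ _ _ ⟨x, hx1, rfl⟩
    · exact LorentzianMetric.causalFuture_mono
        (singleton_subset_iff.2 (c.timeCurve_mem_image_timeSlab x τ₁))
        (LorentzianMetric.chronologicalFuture_subset_causalFuture _ _ _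
          (LorentzianMetric.mem_chronologicalPast_of_mem_chronologicalFuture
            (c.timeCurve_mem_chronologicalFuture hx0 (sub_pos.2 hx1))))
  · obtain ⟨y, hy, hq⟩ := c.exists_mem_causalFuture_of_not_mem_lateImage hmL
    have hℓ : 0 < τ₁ - y.1 0 := by rw [hy]; exact sub_pos.2 hτ₁
    have hr := LorentzianMetric.mem_chronologicalFuture_of_mem_causalFuture
      (WithTop.coe_le_coe.2 le_top) hq (c.timeCurve_mem_chronologicalFuture hy.ge hℓ)
    exact LorentzianMetric.causalFuture_mono
      (singleton_subset_iff.2 (c.timeCurve_mem_image_timeSlab y τ₁))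
      (LorentzianMetric.chronologicalFuture_subset_causalFuture _ _ _
        (LorentzianMetric.mem_chronologicalPast_of_mem_chronologicalFuture hr))

/-- **The decomposition is future-oriented** (clause `IsFutureOriented`, `N = 0`): on every flat
slab `{x⁰ = τ}` with `τ ≥ τ₀` the push-forward `dΨ(∂₀)` is future-directed, by (d). -/
theorem isFutureOriented (c : SoloBlindTiedFlatChart 𝒟 k) : IsFutureOriented c.decomposition := by
  refine ⟨fun i ↦ i.elim0, fun i ↦ i.elim0, ?_⟩
  filter_upwards [eventually_ge_atTop c.τ₀] with τ hτ x hx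
  have hx' : x.1 0 = τ := hx
  exact (c.isTimelike_isFutureDirected x (by rw [hx']; exact hτ)).2

/-- **A tied late flat chart settles the development, with no black hole.** Every clause of the
"settles down" conjunct of `FinalStateConjecture` holds for `𝒟` with `O = J⁺(ι X)` and the `N = 0`
decomposition carried by the chart: subextremality (vacuous), `O = exteriorOf 𝒟 d.charted`,
`RaysStayInClosure`, `HasExhaustiveCharts`, `IsFutureOriented`. Christodoulou–Klainerman 1993,
Thm. 1.0.3 (small data disperse) is the intended source of such charts. -/
theorem settles (c : SoloBlindTiedFlatChart 𝒟 k) :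
    ∃ (O : Set 𝒟.carrier) (d : FinalStateDecomposition 𝒟.toSpacetime O k),
    (∀ i, Kerr.IsSubextremal (d.mass i) (d.spin i)) ∧ O = exteriorOf 𝒟 d.charted ∧
      RaysStayInClosure 𝒟 O ∧ HasExhaustiveCharts d ∧ IsFutureOriented d :=
  ⟨soloBlindDataFuture 𝒟, c.decomposition, fun i ↦ i.elim0, c.dataFuture_eq_exteriorOf,
    raysStayInClosure 𝒟, c.hasExhaustiveCharts, c.isFutureOriented⟩

end SoloBlindTiedFlatChart

/-- **The conclusion of the summit for a vacuum Cauchy development with complete `𝓘⁺` carrying a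
tied late flat chart in `C²`.** -/
theorem soloBlind_conclusion_of_tiedFlatChart (𝒟 : VacuumCauchyDevelopment D)
    (hI : HasCompleteNullInfinity 𝒟.toCauchyDevelopment)
    (c : SoloBlindTiedFlatChart 𝒟.toCauchyDevelopment 2) :
    HasCompleteNullInfinity 𝒟.toCauchyDevelopment ∧
      ∃ (O : Set 𝒟.carrier) (d : FinalStateDecomposition 𝒟.toSpacetime O 2),
        (∀ i, Kerr.IsSubextremal (d.mass i) (d.spin i)) ∧
          O = exteriorOf 𝒟.toCauchyDevelopment d.charted ∧
            RaysStayInClosure 𝒟.toCauchyDevelopment O ∧ HasExhaustiveCharts d ∧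
              IsFutureOriented d :=
  ⟨hI, c.settles⟩

end Development

end Summit.FinalStateConjecture.FinalStateConjecture.Theorems

end
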